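import Literature.AlgebraicGeometry.HodgeTheory.FermatBlowupHostsPackage
import Literature.AlgebraicGeometry.HodgeTheory.FermatHodgeClassesLiftOfBlowupGeometry
import Literature.AlgebraicGeometry.HodgeTheory.SaitoGrFDeRhamCurveNetHolds
import Literature.AlgebraicGeometry.Resolution.ComponentGluing
import Literature.AlgebraicGeometry.Motives.VarietiesUnitProofs
import HarnessLib

/-!
# The two geometric clauses of `FermatHodgeClassesLiftToCurvePowersSum`, modulo the map `ψ`

Topic `Literature/AlgebraicGeometry/HodgeTheory`; theorem-only. The assembly theorem
`FermatHodgeClassesLiftToCurvePowersSum_of_blowupGeometry₃` (file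
`FermatHodgeClassesLiftOfBlowupGeometry`) reduces Shioda–Katsura's Thm. I (the named fact
`FermatHodgeClassesLiftToCurvePowersSum`) to Deligne's Cor. 8.2.8 (`hD`, a tree theorem) and two
geometric clauses `hA'` (`r = 0`) and `hB'` (`r ≥ 1`): the blow-up `Z` of
`Xʳ⁺¹ₘ × X¹ₘ × W` along `Xʳₘ × X⁰ₘ × W` with its exceptional hosts AND a surjection
`f : Z → Xʳ⁺²ₘ × W`. Here both clauses are PROVED from the packaged blow-up
(`HodgeTheory/FermatBlowupHostsPackage.exists_fermatBlowupHosts`, Shioda–Katsura Thm. 1.7 with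
(1.6) and §2 Lemma 2.1) granted only the existence of the surjection `f` on that blow-up — the
extension `ψ : Z → Xʳ⁺²ₘ` of the rational map (1.8),
`(x, y) ↦ (y_{k₀} x_j : ε x_{k₁} y_l)`, `εᵐ = -1`, Thm. 1.7 (i) — stated as the hypothesis `hψ`;
whence `FermatHodgeClassesLiftToCurvePowersSum_of_psi`. The bookkeeping is the associator
`(Xʳ⁺¹ₘ ⊗ X¹ₘ) ⊗ W ≅ Xʳ⁺¹ₘ ⊗ (X¹ₘ ⊗ W)` and, for `r = 0`, the unitor `𝟙 ⊗ W ≅ W` (the hosts of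
the `m²` points `Xᵒₘ × X⁰ₘ` live over `W`).

## References

* T. Shioda, T. Katsura, On Fermat varieties, Tôhoku Math. J. 31 (1979) 97–115, §1 (1.6)–(1.8),
  Thm. 1.7, §2 Lemma 2.1, Cor. 2.5. [ShiodaKatsura1979]
-/

noncomputable section

open CategoryTheory CategoryTheory.Limits AlgebraicGeometry MonoidalCategory

namespace Literature.AlgebraicGeometry.HodgeTheory

open Literature.AlgebraicGeometry.Motives Literature.AlgebraicGeometry.Resolution

/-! ## Transport along an isomorphism of the target

Birationality of `f ≫ e` for an isomorphism `e` is `Resolution.IsBirational.comp_iso`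
(file `Resolution/ResolutionGlue`). -/

/-- `(f ≫ e)⁻¹(e⁻¹⁻¹ U) = f⁻¹ U` for an isomorphism `e`. [folklore] -/
theorem preimage_comp_hom_preimage_inv {X Y Y' : Scheme} (f : X ⟶ Y) (e : Y ≅ Y') (U : Y.Opens) :
    (f ≫ e.hom) ⁻¹ᵁ (e.inv ⁻¹ᵁ U) = f ⁻¹ᵁ U := by
  rw [← Scheme.Hom.comp_preimage, Category.assoc, e.hom_inv_id, Category.comp_id]

/-- If `f` is an isomorphism over `U`, then `f ≫ e` is an isomorphism over `e(U) = e⁻¹⁻¹ U` for an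
isomorphism `e`. [folklore] -/
theorem isIso_morphismRestrict_comp_hom {X Y Y' : Scheme} (f : X ⟶ Y) (e : Y ≅ Y') (U : Y.Opens)
    [IsIso (f ∣_ U)] : IsIso ((f ≫ e.hom) ∣_ (e.inv ⁻¹ᵁ U)) := by
  have hU : e.hom ⁻¹ᵁ (e.inv ⁻¹ᵁ U) = U := by
    rw [← Scheme.Hom.comp_preimage, e.hom_inv_id]
    rfl
  have h1 : IsIso (f ∣_ (e.hom ⁻¹ᵁ (e.inv ⁻¹ᵁ U))) := by
    rw [hU]
    infer_instance
  rw [morphismRestrict_comp]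
  exact @IsIso.comp_isIso _ _ _ _ _ _ _ h1 inferInstance

/-! ## Clause `hB'` (`r ≥ 1`) -/

/-- **Clause `hB'` of `FermatHodgeClassesLiftToCurvePowersSum_of_blowupGeometry₃`, granted the
surjection `ψ`** (`r ≥ 1`: the blow-up of `Xʳ⁺¹ₘ × X¹ₘ × W` along `Xʳₘ × X⁰ₘ × W` with its `m`
exceptional hosts over `Xʳₘ ⊗ W`). [cite: ShiodaKatsura1979, §1 (1.6), Thm. 1.7 and §2 Lemma 2.1] -/
theorem blowupClauseB_of_psi
    (hψ : ∀ (m r : ℕ) (hm : 1 ≤ m) (w : ℕ) (W : SchemeOver ℂ) (_ : IsSmoothProjective w W)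
      (Z : SchemeOver ℂ) (_ : IsSmoothProjective (r + 1 + (1 + w)) Z)
      (bb : Z ⟶ fermatHypersurface (r + 1) m ⊗ (fermatHypersurface 1 m ⊗ W))
      (_ : IsBlowup bb.left
        ((fermatSection (Nat.one_le_iff_ne_zero.mp hm) (Fin.last (r + 2)) :
            fermatHypersurface r m ⟶ fermatHypersurface (r + 1) m).left.ker.comap
          (pullback.fst (fermatHypersurface (r + 1) m).hom (fermatHypersurface 1 m ⊗ W).hom) ⊔
        ((fermatSection (Nat.one_le_iff_ne_zero.mp hm) (Fin.last 2) :
            fermatHypersurface 0 m ⟶ fermatHypersurface 1 m) ▷ W).left.ker.comap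
          (pullback.snd (fermatHypersurface (r + 1) m).hom (fermatHypersurface 1 m ⊗ W).hom))),
      ∃ f : Z ⟶ fermatHypersurface (r + 2) m ⊗ W, Surjective f.left) :
    ∀ (m r : ℕ) (hm : 1 ≤ m) (hr : 1 ≤ r) (w : ℕ) (W : Motives.SchemeOver ℂ)
      (hW : IsSmoothProjective w W) (c : ℕ),
      ∃ (Z : Motives.SchemeOver ℂ) (_ : IsSmoothProjective (r + 2 + w) Z)
        (b : Z ⟶ (fermatHypersurface (r + 1) m ⊗ fermatHypersurface 1 m) ⊗ W) (_ : Resolution.IsBirational b.left)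
        (U : ((fermatHypersurface (r + 1) m ⊗ fermatHypersurface 1 m) ⊗ W).left.Opens) (_ : IsIso (b.left ∣_ U))
        (f : Z ⟶ fermatHypersurface (r + 2) m ⊗ W) (_ : Surjective f.left)
        (T : Type) (_ : Fintype T) (E : T → Motives.SchemeOver ℂ)
        (_ : ∀ t, IsSmoothProjective (r + w + 1) (E t)) (π : ∀ t, E t ⟶ fermatHypersurface r m ⊗ W)
        (_ : ∀ t, Flat (π t).left) (σ : ∀ t, fermatHypersurface r m ⊗ W ⟶ E t) (_ : ∀ t, IsClosedImmersion (σ t).left)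
        (j : ∀ t, E t ⟶ Z) (_ : ∀ t, IsClosedImmersion (j t).left)
        (i : T → (fermatHypersurface r m ⊗ W ⟶ (fermatHypersurface (r + 1) m ⊗ fermatHypersurface 1 m) ⊗ W))
        (_ : ∀ t, IsClosedImmersion (i t).left) (_ : ∀ t, j t ≫ b = π t ≫ i t)
        (_ : Pairwise (Function.onFun Disjoint fun t ↦ Set.range (j t).left.base))
        (_ : ((b.left ⁻¹ᵁ U : Set Z.left))ᶜ = ⋃ t, Set.range (j t).left.base),
        ∀ (t : T) (a : ℕ) (e : complexBetti (E t) a), ∃ p : complexBetti (fermatHypersurface r m ⊗ W) a,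
          complexBetti.restrictCompl (E t) (Set.range (σ t).left.base) a
            (e - complexBetti.map (π t) a p) = 0 := by
  intro m r hm hr w W hW _c
  have hm0 : m ≠ 0 := Nat.one_le_iff_ne_zero.mp hm
  have hX₁ : IsSmoothProjective (r + 1) (fermatHypersurface (r + 1) m) :=
    isSmoothProjective_fermatHypersurface (by omega) hm
  have hBr : IsSmoothProjective r (fermatHypersurface r m) := isSmoothProjective_fermatHypersurface hr hm
  haveI : SmoothOfRelativeDimension r (fermatHypersurface r m).hom :=
    smoothOfRelativeDimension_fermat_hom hm r
  set gS : fermatHypersurface r m ⟶ fermatHypersurface (r + 1) m :=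
    fermatSection hm0 (Fin.last (r + 2)) with hgS
  have hK₁c : IsEffectiveCartier gS.left.ker := isEffectiveCartier_ker_fermatSection hm (Fin.last (r + 2))
  have hsupp : (gS.left.ker.support : Set (fermatHypersurface (r + 1) m).left) =
      fermatCoordHyperplane (r + 1) m (Fin.last (r + 2)) := support_ker_fermatSection hm0 _
  have hK₁ne : (gS.left.ker.support : Set (fermatHypersurface (r + 1) m).left) ≠ Set.univ := by
    obtain ⟨z, hz⟩ := exists_notMem_fermatCoordHyperplane (n := r) (m := m) hm
      (i := 0) (k₀ := Fin.last (r + 2)) (by simp [Fin.ext_iff])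
    rw [hsupp]
    exact fun h ↦ hz (h ▸ Set.mem_univ z)
  obtain ⟨Z, hZ, bb, hb, hbir, U, hU, T, hT, E, hE, π, hπ, σ, hσ, j, hj, i, hi, hsq, hdisj, hcov,
      hEspan⟩ :=
    exists_fermatBlowupHosts hm W hW hX₁ gS.left.ker hK₁c hK₁ne gS (d' := r) rfl hBr (S := Unit)
      (fun _ ↦ gS) (fun _ ↦ comap_ker_self_eq_bot _)
      (fun s s' h ↦ (h (Subsingleton.elim _ _)).elim)
      (fun x hx ↦ Set.mem_iUnion.mpr ⟨(), by
        rw [hsupp, ← range_fermatSection hm0] at hx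
        exact hx⟩)
  obtain ⟨f, hf⟩ := hψ m r hm w W hW Z hZ bb hb
  -- transport along the associator
  let α : (fermatHypersurface (r + 1) m ⊗ fermatHypersurface 1 m) ⊗ W ≅
      fermatHypersurface (r + 1) m ⊗ (fermatHypersurface 1 m ⊗ W) := α_ _ _ _
  let eα : ((fermatHypersurface (r + 1) m ⊗ fermatHypersurface 1 m) ⊗ W).left ≅
      (fermatHypersurface (r + 1) m ⊗ (fermatHypersurface 1 m ⊗ W)).left :=
    (Over.forget _).mapIso α
  haveI : IsIso (bb.left ∣_ U) := hU
  haveI := hi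
  refine ⟨Z, (by omega : r + 1 + (1 + w) = r + 2 + w) ▸ hZ, bb ≫ α.inv, ?_, eα.hom ⁻¹ᵁ U, ?_,
    f, hf, T, hT, E, hE, π, hπ, σ, hσ, j, hj, fun t ↦ i t ≫ α.inv, fun t ↦ ?_, fun t ↦ ?_, hdisj,
    ?_, hEspan⟩
  · exact IsBirational.comp_iso hbir eα.inv
  · exact isIso_morphismRestrict_comp_hom bb.left eα.symm U
  · change IsClosedImmersion ((i t).left ≫ eα.inv)
    infer_instance
  · rw [← Category.assoc, hsq t, Category.assoc]
  · change (((bb.left ≫ eα.symm.hom) ⁻¹ᵁ (eα.symm.inv ⁻¹ᵁ U) : Z.left.Opens) : Set Z.left)ᶜ = _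
    rw [preimage_comp_hom_preimage_inv]
    exact hcov

/-! ## Clause `hA'` (`r = 0`) -/

/-- A rational point of a separated `k`-scheme is a closed immersion. [folklore] -/
theorem isClosedImmersion_of_comp_hom_eq_id {k : Type} [Field k] {X : SchemeOver k}
    [IsSeparated X.hom] (q : Spec (.of k) ⟶ X.left) (hq : q ≫ X.hom = 𝟙 _) :
    IsClosedImmersion q :=
  haveI : IsClosedImmersion (q ≫ X.hom) := by rw [hq]; infer_instance
  IsClosedImmersion.of_comp q X.hom

/-- **Clause `hA'` of `FermatHodgeClassesLiftToCurvePowersSum_of_blowupGeometry₃`, granted the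
surjection `ψ`** (`r = 0`: the blow-up of `X¹ₘ × X¹ₘ × W` at the `m²` points `X⁰ₘ × X⁰ₘ` (times
`W`) with its `m²` exceptional hosts over `W`). [cite: ShiodaKatsura1979, §1 (1.6), Thm. 1.7 and §2 Lemma 2.1, Cor. 2.5] -/
theorem blowupClauseA_of_psi
    (hψ : ∀ (m r : ℕ) (hm : 1 ≤ m) (w : ℕ) (W : SchemeOver ℂ) (_ : IsSmoothProjective w W)
      (Z : SchemeOver ℂ) (_ : IsSmoothProjective (r + 1 + (1 + w)) Z)
      (bb : Z ⟶ fermatHypersurface (r + 1) m ⊗ (fermatHypersurface 1 m ⊗ W))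
      (_ : IsBlowup bb.left
        ((fermatSection (Nat.one_le_iff_ne_zero.mp hm) (Fin.last (r + 2)) :
            fermatHypersurface r m ⟶ fermatHypersurface (r + 1) m).left.ker.comap
          (pullback.fst (fermatHypersurface (r + 1) m).hom (fermatHypersurface 1 m ⊗ W).hom) ⊔
        ((fermatSection (Nat.one_le_iff_ne_zero.mp hm) (Fin.last 2) :
            fermatHypersurface 0 m ⟶ fermatHypersurface 1 m) ▷ W).left.ker.comap
          (pullback.snd (fermatHypersurface (r + 1) m).hom (fermatHypersurface 1 m ⊗ W).hom))),
      ∃ f : Z ⟶ fermatHypersurface (r + 2) m ⊗ W, Surjective f.left) :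
    ∀ (m : ℕ) (hm : 1 ≤ m) (w : ℕ) (W : Motives.SchemeOver ℂ) (hW : IsSmoothProjective w W)
      (c : ℕ),
      ∃ (Z : Motives.SchemeOver ℂ) (_ : IsSmoothProjective (2 + w) Z)
        (b : Z ⟶ (fermatHypersurface 1 m ⊗ fermatHypersurface 1 m) ⊗ W) (_ : Resolution.IsBirational b.left)
        (U : ((fermatHypersurface 1 m ⊗ fermatHypersurface 1 m) ⊗ W).left.Opens) (_ : IsIso (b.left ∣_ U))
        (f : Z ⟶ fermatHypersurface 2 m ⊗ W) (_ : Surjective f.left)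
        (T : Type) (_ : Fintype T) (E : T → Motives.SchemeOver ℂ)
        (_ : ∀ t, IsSmoothProjective (w + 1) (E t)) (π : ∀ t, E t ⟶ W)
        (_ : ∀ t, Flat (π t).left) (σ : ∀ t, W ⟶ E t) (_ : ∀ t, IsClosedImmersion (σ t).left)
        (j : ∀ t, E t ⟶ Z) (_ : ∀ t, IsClosedImmersion (j t).left)
        (i : T → (W ⟶ (fermatHypersurface 1 m ⊗ fermatHypersurface 1 m) ⊗ W))
        (_ : ∀ t, IsClosedImmersion (i t).left) (_ : ∀ t, j t ≫ b = π t ≫ i t)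
        (_ : Pairwise (Function.onFun Disjoint fun t ↦ Set.range (j t).left.base))
        (_ : ((b.left ⁻¹ᵁ U : Set Z.left))ᶜ = ⋃ t, Set.range (j t).left.base),
        ∀ (t : T) (a : ℕ) (e : complexBetti (E t) a), ∃ p : complexBetti (W) a,
          complexBetti.restrictCompl (E t) (Set.range (σ t).left.base) a
            (e - complexBetti.map (π t) a p) = 0 := by
  intro m hm w W hW _c
  have hm0 : m ≠ 0 := Nat.one_le_iff_ne_zero.mp hm
  have hX₁ : IsSmoothProjective 1 (fermatHypersurface 1 m) :=
    isSmoothProjective_fermatHypersurface le_rfl hm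
  haveI : IsSeparated (fermatHypersurface 1 m).hom := by
    haveI := IsSmoothProjective.isProper_holds hX₁
    infer_instance
  haveI : SmoothOfRelativeDimension 0 (fermatHypersurface 0 m).hom :=
    smoothOfRelativeDimension_fermat_hom hm 0
  set gS : fermatHypersurface 0 m ⟶ fermatHypersurface 1 m := fermatSection hm0 (Fin.last 2) with hgS
  have hK₁c : IsEffectiveCartier gS.left.ker := isEffectiveCartier_ker_fermatSection hm (Fin.last 2)
  have hsupp : (gS.left.ker.support : Set (fermatHypersurface 1 m).left) =
      fermatCoordHyperplane 1 m (Fin.last 2) := support_ker_fermatSection hm0 _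
  have hK₁ne : (gS.left.ker.support : Set (fermatHypersurface 1 m).left) ≠ Set.univ := by
    obtain ⟨z, hz⟩ := exists_notMem_fermatCoordHyperplane (n := 0) (m := m) hm
      (i := 0) (k₀ := Fin.last 2) (by simp [Fin.ext_iff])
    rw [hsupp]
    exact fun h ↦ hz (h ▸ Set.mem_univ z)
  -- the `m` points of `X⁰ₘ` on the first factor
  obtain ⟨S, _, q, hq1, hqK, hqinj, -, hqcov⟩ := exists_fermatCurve_pointFamily hm (Fin.last 2)
  let g : S → (𝟙_ (SchemeOver ℂ) ⟶ fermatHypersurface 1 m) := fun s ↦ Over.homMk (q s) (hq1 s)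
  haveI : ∀ s, IsClosedImmersion (g s).left := fun s ↦
    isClosedImmersion_of_comp_hom_eq_id (q s) (hq1 s)
  have hB₁ : IsSmoothProjective 0 (𝟙_ (SchemeOver ℂ)) := isSmoothProjective_unit_holds ℂ
  obtain ⟨Z, hZ, bb, hb, hbir, U, hU, T, hT, E, hE, π, hπ, σ, hσ, j, hj, i, hi, hsq, hdisj, hcov,
      hEspan⟩ :=
    exists_fermatBlowupHosts hm W hW hX₁ gS.left.ker hK₁c hK₁ne gS (d' := 0) rfl hB₁ g
      (fun s ↦ hqK s)
      (fun s s' h ↦ by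
        change Disjoint (Set.range (q s)) (Set.range (q s'))
        rw [range_point_left, range_point_left, Set.disjoint_singleton]
        exact fun h' ↦ h (hqinj h'))
      (fun x hx ↦ by
        rw [hsupp] at hx
        obtain ⟨s, hs⟩ := hqcov x hx
        exact Set.mem_iUnion.mpr ⟨s, IsLocalRing.closedPoint ℂ, hs⟩)
  obtain ⟨f, hf⟩ := hψ m 0 hm w W hW Z hZ bb hb
  -- transport along the associator and the unitor
  let α : (fermatHypersurface 1 m ⊗ fermatHypersurface 1 m) ⊗ W ≅
      fermatHypersurface 1 m ⊗ (fermatHypersurface 1 m ⊗ W) := α_ _ _ _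
  let eα : ((fermatHypersurface 1 m ⊗ fermatHypersurface 1 m) ⊗ W).left ≅
      (fermatHypersurface 1 m ⊗ (fermatHypersurface 1 m ⊗ W)).left :=
    (Over.forget _).mapIso α
  let lam : 𝟙_ (SchemeOver ℂ) ⊗ W ≅ W := λ_ W
  let el : (𝟙_ (SchemeOver ℂ) ⊗ W).left ≅ W.left := (Over.forget _).mapIso lam
  haveI : IsIso (bb.left ∣_ U) := hU
  haveI := hi
  haveI := hσ
  haveI := hπ
  refine ⟨Z, (by omega : 0 + 1 + (1 + w) = 2 + w) ▸ hZ, bb ≫ α.inv, ?_, eα.hom ⁻¹ᵁ U, ?_,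
    f, hf, T, hT, E, fun t ↦ (by omega : 0 + w + 1 = w + 1) ▸ hE t, fun t ↦ π t ≫ lam.hom,
    fun t ↦ ?_, fun t ↦ lam.inv ≫ σ t, fun t ↦ ?_, j, hj, fun t ↦ lam.inv ≫ i t ≫ α.inv,
    fun t ↦ ?_, fun t ↦ ?_, hdisj, ?_, fun t a e ↦ ?_⟩
  · exact IsBirational.comp_iso hbir eα.inv
  · exact isIso_morphismRestrict_comp_hom bb.left eα.symm U
  · change Flat ((π t).left ≫ el.hom)
    infer_instance
  · change IsClosedImmersion (el.inv ≫ (σ t).left)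
    infer_instance
  · change IsClosedImmersion (el.inv ≫ (i t).left ≫ eα.inv)
    infer_instance
  · rw [Category.assoc, lam.hom_inv_id_assoc, ← Category.assoc, hsq t, Category.assoc]
  · change (((bb.left ≫ eα.symm.hom) ⁻¹ᵁ (eα.symm.inv ⁻¹ᵁ U) : Z.left.Opens) : Set Z.left)ᶜ = _
    rw [preimage_comp_hom_preimage_inv]
    exact hcov
  · obtain ⟨p, hp⟩ := hEspan t a e
    refine ⟨complexBetti.map lam.inv a p, ?_⟩
    have hrange : Set.range (lam.inv ≫ σ t).left.base = Set.range (σ t).left.base := by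
      change Set.range (el.inv ≫ (σ t).left).base = _
      rw [Scheme.Hom.comp_base, TopCat.coe_comp, el.inv.surjective.range_comp]
    rw [hrange, complexBetti.map_comp_apply' (π t) lam.hom,
      ← complexBetti.map_comp_apply' lam.hom lam.inv, lam.hom_inv_id, complexBetti.map_id,
      ModuleCat.id_apply]
    exact hp

/-! ## The fact, granted `ψ` -/

/-- **`FermatHodgeClassesLiftToCurvePowersSum` granted the surjection `ψ : Z → Xʳ⁺²ₘ × W` on
Shioda–Katsura's blow-up** (their Thm. 1.7 (i): the rational map (1.8) extends to the blow-up and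
is onto): everything else — the blow-up with its exceptional `ℙ¹`-bundles (Thm. 1.7 (ii)), the
blow-up formula (Lemma 2.1), Deligne's Cor. 8.2.8, the cohomological induction (Prop. 2.4,
Cor. 2.5, Thm. I) — is proved in the tree. [cite: ShiodaKatsura1979, Thm. 1.7, Lemma 2.1, Prop. 2.4, Cor. 2.5] -/
theorem FermatHodgeClassesLiftToCurvePowersSum_of_psi
    (hψ : ∀ (m r : ℕ) (hm : 1 ≤ m) (w : ℕ) (W : SchemeOver ℂ) (_ : IsSmoothProjective w W)
      (Z : SchemeOver ℂ) (_ : IsSmoothProjective (r + 1 + (1 + w)) Z)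
      (bb : Z ⟶ fermatHypersurface (r + 1) m ⊗ (fermatHypersurface 1 m ⊗ W))
      (_ : IsBlowup bb.left
        ((fermatSection (Nat.one_le_iff_ne_zero.mp hm) (Fin.last (r + 2)) :
            fermatHypersurface r m ⟶ fermatHypersurface (r + 1) m).left.ker.comap
          (pullback.fst (fermatHypersurface (r + 1) m).hom (fermatHypersurface 1 m ⊗ W).hom) ⊔
        ((fermatSection (Nat.one_le_iff_ne_zero.mp hm) (Fin.last 2) :
            fermatHypersurface 0 m ⟶ fermatHypersurface 1 m) ▷ W).left.ker.comap
          (pullback.snd (fermatHypersurface (r + 1) m).hom (fermatHypersurface 1 m ⊗ W).hom))),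
      ∃ f : Z ⟶ fermatHypersurface (r + 2) m ⊗ W, Surjective f.left) :
    FermatHodgeClassesLiftToCurvePowersSum :=
  FermatHodgeClassesLiftToCurvePowersSum_of_blowupGeometry₃
    Deligne1974_ker_restrictCompl_eq_iSup_range_complexGysin_holds
    (blowupClauseA_of_psi hψ) (blowupClauseB_of_psi hψ)

end Literature.AlgebraicGeometry.HodgeTheory

end
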